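import Summits.AtomisticToContinuum.Crystallization.Theorems.FrustratedLawDichotomyCellF1HostTable

/-!
# FrustratedLawDichotomy · crux `AperiodicFrustratedLawGap` (stmt-AtomisticToContinuum-27623) — class-A K-file skeleton, layer 5b:
the F1 HOST COLUMN — named reading, label-wise certification, and the ONE fold (decomp-a2c hand-2 g47, structural share; TOY 9
`hostR/hostN`, `hhost9`, `host_fold`, `host_sum_ge` at F1 scale; KFILE-FORMAT ed2c §3′ «THE ONE FOLD», rule G5)

`hostF1 m = k_{q(m)}/2³²` read from layer 5a's table (NAMED column), certified label-wise — ★ `hhost_F1`: for every `F` of the strain cell and every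
non-root label, `hostF1 m ≤ φ(‖posL F (aF1 m)‖²)` ((261) `host_of_nearId` with the layer-3e windows and layer-5a `pH_sound`, transported by the
hit-check; no per-label arithmetic) — and folded ONCE in the kernel over the 14 064 non-root labels: ★ `host_fold` (an INTEGER sum,
`Σ k = −6114160452`) ⇒ ★ `host_sum_ge`: `−6114160452/2³² = −1.42356… ≤ Σ_{m ∈ MF1∖0} hostF1 m` — the `hhost`/`hH` binders of TOY 9's
`K9_le_certFloorL_gen` for the F1 cell.  This is the window-energy part (`≈ E_window`) of the F1 K-number, now a theorem.
-/

namespace Summit.AtomisticToContinuum.Crystallization.Theorems.FrustratedLawDichotomyCellF1HostCol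

open scoped BigOperators
open Summit.AtomisticToContinuum.Crystallization.Theorems.FrustratedLawDichotomyCellBST
open Summit.AtomisticToContinuum.Crystallization.Theorems.FrustratedLawDichotomyCoherentFloorAlgebra (phiT)
open Summit.AtomisticToContinuum.Crystallization.Theorems.FrustratedLawDichotomyShellMinimum (shellMin)
open Summit.AtomisticToContinuum.Crystallization.Theorems.FrustratedLawDichotomyCellMetric (posL)
open Summit.AtomisticToContinuum.Crystallization.Theorems.FrustratedLawDichotomyCellClasses (host_of_nearId)
open Summit.AtomisticToContinuum.Crystallization.Theorems.FrustratedLawDichotomyCellF1Frame (qk)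
open Summit.AtomisticToContinuum.Crystallization.Theorems.FrustratedLawDichotomyCellF1Labels
  (labF1 qkF qkF_eq MF1 mem_M mem_labF1 labF1_nodup)
open Summit.AtomisticToContinuum.Crystallization.Theorems.FrustratedLawDichotomyCellF1Pos (aF1)
open Summit.AtomisticToContinuum.Crystallization.Theorems.FrustratedLawDichotomyCellF1ClassWin (loF1 hiF1 hloW_F1 hhiW_F1)
open Summit.AtomisticToContinuum.Crystallization.Theorems.FrustratedLawDichotomyCellF1HostTable
  (treeH pH loZ hiZ pH_sound treeH_ok treeH_hits)

/-- the non-root labels as a filtered list. -/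
def labF1' : List (ℤ × ℤ × ℤ) := labF1.filter fun x => decide (x ≠ 0)

/-- the integer host reading of a label: `k_{q(m)}` from the table (root / miss ↦ 0). -/
def hostK (m : ℤ × ℤ × ℤ) : ℤ := treeH.findD (qkF m) 0

/-- ★ the HOST COLUMN, NAMED (rule G5): `hostF1 m = k_{q(m)} / 2³²`. -/
noncomputable def hostF1 (m : ℤ × ℤ × ℤ) : ℝ := (hostK m : ℝ) / 2 ^ 32

/-- `MF1 ∖ {0}` is the filtered list (membership by predicate). -/
theorem erase_MF1_eq : MF1.erase 0 = labF1'.toFinset := by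
  ext x
  simp only [Finset.mem_erase, labF1', List.mem_toFinset, List.mem_filter, decide_eq_true_eq, mem_M, mem_labF1]
  tauto

/-- the filtered list has no duplicates. -/
theorem labF1'_nodup : labF1'.Nodup := labF1_nodup.filter _

/-- casts of the rational window ends to the real per-label windows of layer 3e. -/
theorem loZ_cast (m : ℤ × ℤ × ℤ) : ((loZ (qkF m) : ℚ) : ℝ) = loF1 m := by
  unfold loZ loF1; rw [qkF_eq]; push_cast; ring

/-- casts of the rational window ends to the real per-label windows of layer 3e. -/
theorem hiZ_cast (m : ℤ × ℤ × ℤ) : ((hiZ (qkF m) : ℚ) : ℝ) = hiF1 m := by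
  unfold hiZ hiF1; rw [qkF_eq]; push_cast; ring

/-- ★ LABEL-WISE CERTIFICATION of the host column: under every `F` of the strain cell, `hostF1 m ≤ φ(‖posL F (aF1 m)‖²)` for every non-root label
(the `hhost` binder of the generic assembly). -/
theorem hhost_F1 {F : Matrix (Fin 3) (Fin 3) ℝ} (hG : ∀ i j, |(F.transpose * F) i j - (if i = j then 1 else 0)| ≤ 1 / 1024) :
    ∀ m ∈ MF1.erase 0, hostF1 m ≤ phiT (‖posL F (aF1 m)‖ ^ 2) := by
  intro m hm
  rw [erase_MF1_eq, List.mem_toFinset] at hm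
  have hp : pH (qkF m) (hostK m) = true := BT.all_findD treeH_ok (treeH_hits m hm) 0
  obtain ⟨h0, hv⟩ := pH_sound hp
  rw [loZ_cast] at h0
  rw [loZ_cast, hiZ_cast] at hv
  exact host_of_nearId hG (aF1 m) h0 (hloW_F1 m) (hhiW_F1 m) hv

/-- ★ THE HOST FOLD: one INTEGER pass over the 14 064 non-root labels (`Σ k = −6114160452`). -/
theorem host_fold : (-6114160452 : ℤ) ≤ (labF1'.map hostK).sum := by decide +kernel

/-- ★ the host SUM of the F1 cell: `−6114160452/2³² ≈ −1.4235639 ≤ Σ_{m ∈ MF1∖0} hostF1 m` (the `hH` binder of the generic assembly). -/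
theorem host_sum_ge : ((-6114160452 : ℤ) : ℝ) / 2 ^ 32 ≤ ∑ m ∈ MF1.erase 0, hostF1 m := by
  have hS : ∑ m ∈ MF1.erase 0, hostF1 m = (∑ m ∈ MF1.erase 0, (hostK m : ℝ)) / 2 ^ 32 := by
    rw [Finset.sum_div]; rfl
  have hZ : ∑ m ∈ MF1.erase 0, (hostK m : ℝ) = (((labF1'.map hostK).sum : ℤ) : ℝ) := by
    rw [erase_MF1_eq, List.sum_toFinset _ labF1'_nodup, Int.cast_list_sum, List.map_map]; rfl
  rw [hS, hZ]
  exact div_le_div_of_nonneg_right (by exact_mod_cast host_fold) (by positivity)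

end Summit.AtomisticToContinuum.Crystallization.Theorems.FrustratedLawDichotomyCellF1HostCol
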